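import Summits.AnomalousDissipation.AnomalousDissipation.Theses.MarginalStabilityChain
import Summits.AnomalousDissipation.AnomalousDissipation.Theses.CoherentStates
import Summits.AnomalousDissipation.AnomalousDissipation.Theses.Neg
import Summits.AnomalousDissipation.AnomalousDissipation.Theorems.TwohalfdNeg.Negative.LaminarShear
import Summits.AnomalousDissipation.AnomalousDissipation.Theorems.TwohalfdNeg.Negative.ZeroMeanAndKillShape
import Literature.Analysis.FluidPDE.DoeringFoiasProofs
import Literature.Analysis.FluidPDE.DoeringFoiasPowerProofs
import Literature.Analysis.FluidPDE.LongTimeAverageNonneg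
import Literature.Analysis.FluidPDE.ZerothLawProofs

/-!
# Disproof of `ChainThesis` — work file of the standing adversary (cdisprove) on the crux
# `MarginalStabilityChain.ChainThesis` (stmt-AnomalousDissipation-3005, route target, rank 0)

THE CRUX (read back from the elaborated term): `∃ f : T³ → ℝ³` smooth, solenoidal, mean zero, `∃ ν : ℕ → ℝ`,
`u : ℕ → ℝ → T³ → ℝ³`, `p : ℕ → ℝ → T³ → ℝ` with `0 < ν j`, `ν j → 0`, each `(u j, p j)` a CLASSICAL solution of
NS_{ν j} forced by the STEADY `f` on ALL of `ℝ × T³` (`Torus.IsClassicalNSSolutionOn univ`: jointly `C^∞`, pointwise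
momentum equation with one-sided time derivative — two-sided on `univ` —, `div u = 0`), `∃ E ∀ j, meanEnergy (u j) ≤ E`
(`meanEnergy = limsup_T T⁻¹∫₀ᵀ‖u‖₂²`, junk `0` on unbounded Cesàro means) and `∃ ε > 0 ∀ j, ε ≤ meanDissipation (ν j) (u j)`
(`limsup_T T⁻¹∫₀ᵀ ν‖∇u‖₂²`, spectral gradient through `toReal`).  It is the zeroth law of turbulence in the broadest
smooth class for ONE fixed steady force: `CoherentStates.CoherentThesis` (periodic) ⇒ `ChainThesis` ⇒
`AnomalousDissipation` (Leray–Hopf), all open in print (Bruè–De Lellis 2023 Questions 2.1–2.2 concern even the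
finite-time, `ν`-independent-force version).  A KILL is a proof of `ChainNeg` below: "for every steady smooth force,
every bounded-energy family of complete classical trajectories has `ν_j⟨‖∇u_j‖²⟩ → 0`" — the negative zeroth law
in the classical class, equally open.  Prose lives in docstrings only.

FINDINGS INDEX (kernel-checked unless marked PAPER):
* §1 `chainThesisWithoutPos_iff` — the clause `∀ j, 0 < ν j` is DECORATION: `ε > 0` and `ε ≤ meanDissipation (ν j) (u j)`
  force `ν j > 0` (`meanDissipation_nonpos_of_nonpos`, junk included).
* §2 THE POWER BUDGET of every witness (Doering–Foias, in tree: `DoeringFoias2002_dissipation_le_power_holds`,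
  `Torus.IsGlobalLerayHopf.meanPower_le`, classical ⇒ Leray–Hopf): `ε ≤ meanDissipation ≤ ‖f‖₂ √(meanEnergy) ≤ ‖f‖₂√E`
  (`witness_budget`), hence `chainThesis_false_unforced` (the statement with `f = 0` is FALSE: free eternal
  trajectories have zero mean dissipation), `witness_energy_floor` (`ε² ≤ ‖f‖₂²·E`: the ceiling cannot be below the
  injection scale) — the only inequality valid for every witness; it is scale-covariant (§2b) and consistent.
* §3 LOAD-BEARING CLAUSES — each deletion makes the ∃-statement TRIVIALLY TRUE (explicit laminar witnesses, so the clause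
  must be USED by any disproof and cannot be what a proof exploits):
  `chainThesisWithoutEnergyBound_holds` (drop `∃ E`: fixed `f = (0,0,cos 2πx₀)`, `u_j = f/(4π²ν_j)`, dissipation
  `(j+1)/(8π²) → ∞`), `chainThesisWithoutVanishingViscosity_holds` (drop `ν_j → 0`: `ν = 1`),
  `chainThesisWithoutZeroMeanForce_holds` (drop `HasZeroMean f`: TRUE THROUGH THE JUNK — fixed `f = (0,0,cos 2πx₀ + 1)`,
  accelerating laminar states `(0,0,cos(2πx₀)/(4π²ν_j) + t)`, Cesàro energies `∝ T²` ⇒ `meanEnergy = 0`, dissipation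
  honest `(j+1)/(8π²)`).  Reading: `HasZeroMean f` is exactly what makes the energy ceiling MEANINGFUL (§4).
* §4 HONESTY `timeMean_energy_le`: for every complete classical trajectory with `ν > 0` and a smooth mean-zero steady force
  the Cesàro means of the energy are bounded for `T ≥ 1` (momentum conservation + Poincaré + energy inequality, in tree:
  `Torus.IsGlobalLerayHopf.timeMean_norm_sq_le`), so `meanEnergy (u j) ≤ E` is an honest `limsup` bound — the junk door
  of §3 is closed by `HasZeroMean f`; the `toReal` junk of `meanDissipation` is void on smooth slices.
* §5 KILL SHAPE `not_chainThesis_iff_chainNeg` (subsequence extraction + `meanDissipation_nonneg`); HIERARCHY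
  `chainNeg_of_negThesis` (`Neg.NegThesis ⇒ ChainNeg ⇔ ¬ChainThesis`), `not_coherentThesis_of_not_chainThesis`
  (a kill here kills route CoherentStates' target), `not_chainThesis_of_not_anomalousDissipation`.
* §6 REFUTED STRENGTHENINGS of the witness class: `not_chainThesis_boundedEnstrophy` (no witness family with `ν`-uniformly
  bounded mean enstrophy `⟨‖∇u_j‖²⟩ ≤ G`: then `meanDissipation ≤ ν_j G → 0`) — the Taylor scale `λ_j² = Eν_j/ε` of a
  witness must vanish; PAPER (not formalised here, see docstrings of §6): (a) no witness in which the inertial term is a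
  gradient for every `j` (parallel / Stokes / single-shell Beltrami families: linear balance `u ~ Δ⁻¹f/ν`, energy `∝ ν⁻²`
  or zero injection); (b) no witness uniformly bounded in `L³_t B^σ_{3,∞}`, `σ > 1/3` (Drivas–Eyink 2019 Lemma 1, tree
  barrier `DrivasEyink2019_lemma1_measurable`, discharged) — witnesses are Onsager-critical, as the route's BARRIERS
  section already concedes; (c) no steady purely two-dimensional witness (Alexakis–Doering, tree barrier
  `AlexakisDoering2006_energyDissipationBound`).

VERDICT SO FAR: no kill and no formal loophole.  The statement is an honest transcription; its only cheap
consequences are the power budget (§2) and the hierarchy (§5).  WHY IT RESISTS: a disproof is the negative zeroth law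
for complete classical trajectories under ONE steady force (universally quantified over forces AND families) — strictly
harder than `Neg.NegThesis` restricted to classical families, and blocked for force-robust velocity-level estimates by
`Literature.Barriers.AnomalousDissipation.Cheskidov2023_thm13_not_forceRobustNoAnomaly` (time-periodic `f^ν → f`) and its
steady in-class shadow `TwohalfdNeg.Negative.twohalfdNeg_false_without_fixedForce` (steady `f_j ⇀ 0`, `‖f_j‖_∞` fixed,
dissipation `2π²` at every level): any proof of `ChainNeg` must use that `f` is ONE FIXED smooth field.  A proof of the
crux, dually, needs `ν`-uniform energy bounds with persistent `O(1)` injection along complete smooth trajectories — the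
route's disruption-chain mechanism; nothing explicit is known (every explicit eternal classical solution — laminar,
Beltrami, swept — balances `f` by viscosity, §6(a)).
-/

noncomputable section

set_option linter.dupNamespace false

namespace Summit.AnomalousDissipation.AnomalousDissipation.Cruxes.ChainThesis.Disproof

open MeasureTheory Set Filter Topology UnitAddTorus
open scoped ENNReal NNReal InnerProductSpace
open Literature.Analysis.FunctionSpaces Literature.Analysis.FunctionSpaces.Torus
open Literature.Analysis.FluidPDE Literature.Analysis.FluidPDE.Torus
open Summit.AnomalousDissipation.AnomalousDissipation.Theses
open Summit.AnomalousDissipation.AnomalousDissipation.Theses.MarginalStabilityChain (ChainThesis)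
open Summit.AnomalousDissipation.AnomalousDissipation.Theorems.TwohalfdNeg.Negative

/-- Local notation: the torus `T³`. -/
local notation "𝕋³" => UnitAddTorus (Fin 3)
/-- Local notation: velocity values. -/
local notation "E³" => EuclideanSpace ℝ (Fin 3)
/-- Local notation: the planar torus `T²`. -/
local notation "𝕋²" => UnitAddTorus (Fin 2)
/-- Local notation: planar velocity values. -/
local notation "E²" => EuclideanSpace ℝ (Fin 2)

/-! ## §0 The crux unfolded -/

/-- The crux, unfolded (definitional). [folklore] -/
theorem chainThesis_iff :
    ChainThesis ↔
      ∃ f : 𝕋³ → E³, IsSmooth f ∧ IsDivFree f ∧ HasZeroMean f ∧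
        ∃ (ν : ℕ → ℝ) (u : ℕ → ℝ → 𝕋³ → E³) (p : ℕ → ℝ → 𝕋³ → ℝ),
          (∀ j, 0 < ν j) ∧ Tendsto ν atTop (𝓝 0) ∧
          (∀ j, IsClassicalNSSolutionOn univ (ν j) (fun _ => f) (u j) (p j)) ∧
          (∃ E : ℝ, ∀ j, meanEnergy (u j) ≤ E) ∧
          ∃ ε : ℝ, 0 < ε ∧ ∀ j, ε ≤ meanDissipation (ν j) (u j) :=
  Iff.rfl

/-! ## §1 Decoration: positivity of the viscosities is forced by the dissipation floor -/

/-- A real `limsup` of an eventually nonpositive function is nonpositive, junk value included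
(`limsup = sInf {a | ∀ᶠ i, g i ≤ a}` contains `0`; `Real.sInf` of a set unbounded below is `0`). [folklore] -/
theorem limsup_nonpos_of_eventually_nonpos {ι : Type*} {l : Filter ι} {g : ι → ℝ}
    (hg : ∀ᶠ i in l, g i ≤ 0) : limsup g l ≤ 0 := by
  rw [Filter.limsup_eq]
  have h0 : (0 : ℝ) ∈ {a : ℝ | ∀ᶠ i in l, g i ≤ a} := hg
  by_cases hb : BddBelow {a : ℝ | ∀ᶠ i in l, g i ≤ a}
  · exact csInf_le hb h0
  · rw [Real.sInf_of_not_bddBelow hb]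

/-- Cesàro means of a nonpositive function are nonpositive (`T ≥ 0`; junk `∫ = 0` included). [folklore] -/
theorem timeMean_nonpos {g : ℝ → ℝ} (hg : ∀ t, g t ≤ 0) {T : ℝ} (hT : 0 ≤ T) : timeMean g T ≤ 0 := by
  unfold timeMean
  have h : 0 ≤ ∫ t in (0 : ℝ)..T, -g t :=
    intervalIntegral.integral_nonneg hT fun t _ => neg_nonneg.mpr (hg t)
  rw [intervalIntegral.integral_neg] at h
  exact mul_nonpos_iff.2 (Or.inl ⟨inv_nonneg.mpr hT, neg_nonneg.mp h⟩)

/-- Long-time averages of nonpositive functions are nonpositive, junk included. [folklore] -/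
theorem longTimeAvgSup_nonpos {g : ℝ → ℝ} (hg : ∀ t, g t ≤ 0) : longTimeAvgSup g ≤ 0 := by
  unfold longTimeAvgSup
  refine limsup_nonpos_of_eventually_nonpos ?_
  filter_upwards [eventually_ge_atTop (0 : ℝ)] with T hT
  exact timeMean_nonpos hg hT

/-- For `ν ≤ 0` the mean dissipation `⟨ν‖∇u‖²⟩` is `≤ 0` (every slice contributes `ν · toReal _ ≤ 0`). [folklore] -/
theorem meanDissipation_nonpos_of_nonpos {ν : ℝ} (hν : ν ≤ 0) (u : ℝ → 𝕋³ → E³) :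
    meanDissipation ν u ≤ 0 :=
  longTimeAvgSup_nonpos fun _ => mul_nonpos_iff.2 (Or.inr ⟨hν, ENNReal.toReal_nonneg⟩)

/-- `ChainThesis` with the clause `∀ j, 0 < ν j` DELETED (everything else verbatim). -/
def ChainThesisWithoutPos : Prop :=
  ∃ f : 𝕋³ → E³, IsSmooth f ∧ IsDivFree f ∧ HasZeroMean f ∧
    ∃ (ν : ℕ → ℝ) (u : ℕ → ℝ → 𝕋³ → E³) (p : ℕ → ℝ → 𝕋³ → ℝ),
      Tendsto ν atTop (𝓝 0) ∧
      (∀ j, IsClassicalNSSolutionOn univ (ν j) (fun _ => f) (u j) (p j)) ∧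
      (∃ E : ℝ, ∀ j, meanEnergy (u j) ≤ E) ∧
      ∃ ε : ℝ, 0 < ε ∧ ∀ j, ε ≤ meanDissipation (ν j) (u j)

/-- **DECORATION.** `0 < ν j` is implied by the dissipation floor: `0 < ε ≤ meanDissipation (ν j) (u j)` is
impossible for `ν j ≤ 0` (`meanDissipation_nonpos_of_nonpos`).  So the crux with the positivity clause deleted is
EQUIVALENT to the crux (backward NS / Euler members are excluded automatically). [folklore] -/
theorem chainThesisWithoutPos_iff : ChainThesisWithoutPos ↔ ChainThesis := by
  constructor
  · rintro ⟨f, hs, hd, hz, ν, u, p, hν0, hsol, hE, ε, hε, hεj⟩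
    refine ⟨f, hs, hd, hz, ν, u, p, fun j => ?_, hν0, hsol, hE, ε, hε, hεj⟩
    by_contra hle
    exact (lt_irrefl (0 : ℝ))
      ((hε.trans_le (hεj j)).trans_le (meanDissipation_nonpos_of_nonpos (not_lt.mp hle) _))
  · rintro ⟨f, hs, hd, hz, ν, u, p, -, hν0, hsol, hE, ε, hε, hεj⟩
    exact ⟨f, hs, hd, hz, ν, u, p, hν0, hsol, hE, ε, hε, hεj⟩

/-! ## §2 The power budget of every witness -/

/-- **Doering–Foias budget for one complete classical trajectory**: `⟨ν‖∇u‖²⟩ ≤ ‖f‖₂ · √⟨‖u‖²⟩` for a steady smooth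
mean-zero force and `ν > 0` (classical on `univ` ⇒ global Leray–Hopf from `u 0`; then `ε ≤ ⟨f·u⟩ ≤ ‖f‖₂ U`, both in
tree). [cite: CheskidovDoeringPetrov2006, eq. (11) and eq. (17)] -/
theorem meanDissipation_le_of_classical {ν : ℝ} (hν : 0 < ν) {f : 𝕋³ → E³} (hf : IsSmooth f)
    (hf0 : HasZeroMean f) {u : ℝ → 𝕋³ → E³} {p : ℝ → 𝕋³ → ℝ}
    (h : IsClassicalNSSolutionOn univ ν (fun _ => f) u p) :
    meanDissipation ν u ≤ Real.sqrt (∫ x, ‖f x‖ ^ 2) * Real.sqrt (meanEnergy u) := by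
  have hLH := h.isGlobalLerayHopf
  have h1 := DoeringFoias2002_dissipation_le_power_holds hν (hf.memLp 2) hf0 (u 0) u hLH
  have h2 := hLH.meanPower_le hν hf hf0
  rw [rmsVelocity_eq_sqrt_meanEnergy] at h2
  exact h1.trans h2

/-- **BUDGET OF A WITNESS**: at any level `j` of a `ChainThesis` witness, `ε ≤ ‖f‖₂ √E`. [folklore] -/
theorem witness_budget {ν : ℝ} (hν : 0 < ν) {f : 𝕋³ → E³} (hf : IsSmooth f) (hf0 : HasZeroMean f)
    {u : ℝ → 𝕋³ → E³} {p : ℝ → 𝕋³ → ℝ} (h : IsClassicalNSSolutionOn univ ν (fun _ => f) u p)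
    {E ε : ℝ} (hE : meanEnergy u ≤ E) (hε : ε ≤ meanDissipation ν u) :
    ε ≤ Real.sqrt (∫ x, ‖f x‖ ^ 2) * Real.sqrt E :=
  hε.trans ((meanDissipation_le_of_classical hν hf hf0 h).trans
    (mul_le_mul_of_nonneg_left (Real.sqrt_le_sqrt hE) (Real.sqrt_nonneg _)))

/-- **ENERGY FLOOR OF A WITNESS**: `ε² ≤ ‖f‖₂² · E` — the energy ceiling of a witness is at least `(ε/‖f‖₂)²`; in
Kolmogorov units (`ε ≍ U³/L`, `‖f‖₂ ≍ U²/L`) this is `U² ≲ E`, consistent and scale-covariant. [folklore] -/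
theorem witness_energy_floor {ν : ℝ} (hν : 0 < ν) {f : 𝕋³ → E³} (hf : IsSmooth f) (hf0 : HasZeroMean f)
    {u : ℝ → 𝕋³ → E³} {p : ℝ → 𝕋³ → ℝ} (h : IsClassicalNSSolutionOn univ ν (fun _ => f) u p)
    {E ε : ℝ} (hE : meanEnergy u ≤ E) (hε0 : 0 < ε) (hε : ε ≤ meanDissipation ν u) :
    ε ^ 2 ≤ (∫ x, ‖f x‖ ^ 2) * E := by
  have hb := witness_budget hν hf hf0 h hE hε
  have hE0 : 0 ≤ E := (meanEnergy_nonneg u).trans hE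
  have hF0 : 0 ≤ ∫ x, ‖f x‖ ^ 2 := integral_nonneg fun _ => sq_nonneg _
  calc ε ^ 2 ≤ (Real.sqrt (∫ x, ‖f x‖ ^ 2) * Real.sqrt E) ^ 2 := by gcongr
    _ = (∫ x, ‖f x‖ ^ 2) * E := by
        rw [mul_pow, Real.sq_sqrt hF0, Real.sq_sqrt hE0]

/-- `ChainThesis` with the force set to `0` (the clauses on `f` become vacuous and are dropped). -/
def ChainThesisUnforced : Prop :=
  ∃ (ν : ℕ → ℝ) (u : ℕ → ℝ → 𝕋³ → E³) (p : ℕ → ℝ → 𝕋³ → ℝ),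
    (∀ j, 0 < ν j) ∧ Tendsto ν atTop (𝓝 0) ∧
    (∀ j, IsClassicalNSSolutionOn univ (ν j) (fun _ => (0 : 𝕋³ → E³)) (u j) (p j)) ∧
    (∃ E : ℝ, ∀ j, meanEnergy (u j) ≤ E) ∧
    ∃ ε : ℝ, 0 < ε ∧ ∀ j, ε ≤ meanDissipation (ν j) (u j)

/-- **THE FORCE MUST WORK.** The unforced variant is FALSE: free complete classical trajectories have
`meanDissipation = 0` (budget with `‖f‖₂ = 0`: `∫₀ᵀ ν‖∇u‖² ≤ ½‖u(0)‖²`).  Any witness has `f ≠ 0`; the statement does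
not say so, but it need not (information, not a flaw). [folklore] -/
theorem chainThesis_false_unforced : ¬ ChainThesisUnforced := by
  rintro ⟨ν, u, p, hν, -, hsol, ⟨E, hE⟩, ε, hε, hεj⟩
  have hz : HasZeroMean (0 : 𝕋³ → E³) := by simp [HasZeroMean]
  have hb := witness_budget (hν 0) (isSmooth_const (0 : E³)) hz (hsol 0) (hE 0) (hεj 0)
  simp at hb
  exact (lt_irrefl (0 : ℝ)) (hε.trans_le hb)

/-! ## §3 Load-bearing clauses: each deletion is trivially TRUE -/

/-- `ChainThesis` with the energy ceiling `∃ E, ∀ j, meanEnergy (u j) ≤ E` DELETED. -/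
def ChainThesisWithoutEnergyBound : Prop :=
  ∃ f : 𝕋³ → E³, IsSmooth f ∧ IsDivFree f ∧ HasZeroMean f ∧
    ∃ (ν : ℕ → ℝ) (u : ℕ → ℝ → 𝕋³ → E³) (p : ℕ → ℝ → 𝕋³ → ℝ),
      (∀ j, 0 < ν j) ∧ Tendsto ν atTop (𝓝 0) ∧
      (∀ j, IsClassicalNSSolutionOn univ (ν j) (fun _ => f) (u j) (p j)) ∧
      ∃ ε : ℝ, 0 < ε ∧ ∀ j, ε ≤ meanDissipation (ν j) (u j)

/-- The zero planar pressure lifted to `T³` (the pressure of every laminar witness below). [folklore] -/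
def zeroPressure : ℝ → 𝕋³ → ℝ := fun _ => (fun _ : 𝕋² => (0 : ℝ)) ∘ planarProj

/-- Amplitude bookkeeping: `4π²·ν_j·a_j = 1` for `ν_j = 1/(j+1)`, `a_j = (j+1)/(4π²)`. [folklore] -/
theorem amp_rel (j : ℕ) :
    4 * Real.pi ^ 2 * (((0 : ℕ) : ℝ) + 1) ^ 2 * (1 / ((j : ℝ) + 1)) * (((j : ℝ) + 1) / (4 * Real.pi ^ 2)) = 1 := by
  have hj : (j : ℝ) + 1 ≠ 0 := by positivity
  have hπ : (Real.pi : ℝ) ^ 2 ≠ 0 := by positivity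
  push_cast
  field_simp
  ring

/-- Dissipation bookkeeping: `ν_j · 2π²a_j² = (j+1)/(8π²)`. [folklore] -/
theorem diss_rel (j : ℕ) :
    1 / ((j : ℝ) + 1) * (2 * Real.pi ^ 2 * (((0 : ℕ) : ℝ) + 1) ^ 2 * (((j : ℝ) + 1) / (4 * Real.pi ^ 2)) ^ 2) =
      ((j : ℝ) + 1) / (8 * Real.pi ^ 2) := by
  have hj : (j : ℝ) + 1 ≠ 0 := by positivity
  have hπ : (Real.pi : ℝ) ^ 2 ≠ 0 := by positivity
  push_cast
  field_simp
  ring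

/-- **THE ENERGY CEILING IS LOAD-BEARING**: without it the crux is TRIVIALLY TRUE.  Fixed `f = shear 0 1 = (0,0,cos 2πx₀)`,
`ν_j = 1/(j+1)`, steady laminar `u_j = shear 0 ((j+1)/4π²) = f/(4π²ν_j)` (classical on `ℝ × T³`, zero pressure):
`meanDissipation = (j+1)/(8π²) ≥ 1/(8π²)` (energies `(j+1)²/(32π⁴) → ∞`).  So the ceiling must be USED by any disproof,
and a prover cannot get the floor from the laminar response. [folklore] -/
theorem chainThesisWithoutEnergyBound_holds : ChainThesisWithoutEnergyBound := by
  refine ⟨shear 0 1, isSmooth_shear 0 1, isDivFree_shear 0 1, hasZeroMean_shear 0 1,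
    fun j => 1 / ((j : ℝ) + 1), fun j _ => shear 0 (((j : ℝ) + 1) / (4 * Real.pi ^ 2)), fun _ => zeroPressure,
    fun j => by positivity, tendsto_one_div_add_atTop_nhds_zero_nat, fun j => ?_, 1 / (8 * Real.pi ^ 2),
    by positivity, fun j => ?_⟩
  · have h := isClassicalNSSolutionOn_shear 0 (1 / ((j : ℝ) + 1)) (((j : ℝ) + 1) / (4 * Real.pi ^ 2))
    rw [amp_rel j] at h
    exact h
  · rw [meanDissipation_shear, diss_rel j]
    have hj : (0 : ℝ) < (j : ℝ) + 1 := by positivity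
    exact div_le_div_of_nonneg_right (by linarith) (by positivity)

/-- `ChainThesis` with `Tendsto ν atTop (𝓝 0)` DELETED. -/
def ChainThesisWithoutVanishingViscosity : Prop :=
  ∃ f : 𝕋³ → E³, IsSmooth f ∧ IsDivFree f ∧ HasZeroMean f ∧
    ∃ (ν : ℕ → ℝ) (u : ℕ → ℝ → 𝕋³ → E³) (p : ℕ → ℝ → 𝕋³ → ℝ),
      (∀ j, 0 < ν j) ∧
      (∀ j, IsClassicalNSSolutionOn univ (ν j) (fun _ => f) (u j) (p j)) ∧
      (∃ E : ℝ, ∀ j, meanEnergy (u j) ≤ E) ∧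
      ∃ ε : ℝ, 0 < ε ∧ ∀ j, ε ≤ meanDissipation (ν j) (u j)

/-- **`ν_j → 0` IS LOAD-BEARING** (sanity): at `ν = 1` the laminar state `u = shear 0 1` under `f = shear 0 (4π²)` has
energy `1/2` and dissipation `2π²`. [folklore] -/
theorem chainThesisWithoutVanishingViscosity_holds : ChainThesisWithoutVanishingViscosity := by
  refine ⟨shear 0 (4 * Real.pi ^ 2 * (((0 : ℕ) : ℝ) + 1) ^ 2 * 1 * 1), isSmooth_shear _ _, isDivFree_shear _ _,
    hasZeroMean_shear _ _, fun _ => 1, fun _ _ => shear 0 1, fun _ => zeroPressure, fun _ => one_pos,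
    fun _ => isClassicalNSSolutionOn_shear 0 1 1, ⟨1 / 2, fun _ => (meanEnergy_shear 0 1).le.trans (by norm_num)⟩,
    2 * Real.pi ^ 2, by positivity, fun _ => ?_⟩
  rw [meanDissipation_shear]
  push_cast
  nlinarith [Real.pi_pos]

/-- `ChainThesis` with `HasZeroMean f` DELETED. -/
def ChainThesisWithoutZeroMeanForce : Prop :=
  ∃ f : 𝕋³ → E³, IsSmooth f ∧ IsDivFree f ∧
    ∃ (ν : ℕ → ℝ) (u : ℕ → ℝ → 𝕋³ → E³) (p : ℕ → ℝ → 𝕋³ → ℝ),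
      (∀ j, 0 < ν j) ∧ Tendsto ν atTop (𝓝 0) ∧
      (∀ j, IsClassicalNSSolutionOn univ (ν j) (fun _ => f) (u j) (p j)) ∧
      (∃ E : ℝ, ∀ j, meanEnergy (u j) ≤ E) ∧
      ∃ ε : ℝ, 0 < ε ∧ ∀ j, ε ≤ meanDissipation (ν j) (u j)

/-- The accelerating laminar state is a COMPLETE CLASSICAL solution for the fixed force `rampForce c = (0,0,cos 2πx₀ + c)`
when `4π²νa = 1` (packaging theorem `Torus.isClassicalNSSolutionOn_twoHalf`, planar part `0`; cf.
`TwohalfdNeg.Negative.isGlobalLerayHopf_ramp`, which keeps only the Leray–Hopf shadow). [folklore] -/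
theorem isClassicalNSSolutionOn_ramp {ν a : ℝ} (ha : 4 * Real.pi ^ 2 * ν * a = 1) (c : ℝ) :
    IsClassicalNSSolutionOn univ ν (fun _ => rampForce c) (rampState a c) zeroPressure := by
  have hV : IsSmoothSpaceTimeOn univ (fun _ : ℝ => (0 : 𝕋² → E²)) := isSmoothSpaceTimeOn_const isSmooth_zero₂ _
  have hφ : IsSmoothSpaceTimeOn univ (fun _ : ℝ => fun _ : 𝕋² => (0 : ℝ)) :=
    isSmoothSpaceTimeOn_const (isSmooth_const (0 : ℝ)) _
  have hcl := isClassicalNSSolutionOn_twoHalf uniqueDiffOn_univ ν hV (isSmoothSpaceTimeOn_ramp a c) hφ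
    (fun _ _ x => by simp [Torus.divergence, Torus.partialDeriv, Torus.lineDeriv])
  rw [twoHalfForce_ramp ha c] at hcl
  exact hcl

/-- **`HasZeroMean f` IS LOAD-BEARING — THROUGH THE JUNK.**  With the fixed force `rampForce 1 = (0,0,cos 2πx₀ + 1)`
(smooth, solenoidal, mean `e₃ ≠ 0`), `ν_j = 1/(j+1)` and the accelerating laminar COMPLETE CLASSICAL trajectories
`u_j(t) = (0,0,cos(2πx₀)(j+1)/(4π²) + t)`: Cesàro energies grow like `T²/3`, so `meanEnergy (u_j) = 0` (junk,
`meanEnergy_rampState`) and the ceiling holds with `E = 0`, while `meanDissipation = (j+1)/(8π²) ≥ 1/(8π²)` is honest.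
Reading for provers: the clause `HasZeroMean f` is what makes `meanEnergy ≤ E` an honest hypothesis (§4); a proof of the
crux may not route through unbounded Cesàro means. [folklore] -/
theorem chainThesisWithoutZeroMeanForce_holds : ChainThesisWithoutZeroMeanForce := by
  have hsm : IsSmooth (rampForce 1) := isSmooth_zero₂.twoHalf (isSmooth_profile_add_const 1 1)
  have hdf : IsDivFree (rampForce 1) :=
    IsDivFree.twoHalf (fun x => by simp [Torus.divergence, Torus.partialDeriv, Torus.lineDeriv]) _
  have ha : ∀ j : ℕ, 4 * Real.pi ^ 2 * (1 / ((j : ℝ) + 1)) * (((j : ℝ) + 1) / (4 * Real.pi ^ 2)) = 1 := by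
    intro j
    have hj : (j : ℝ) + 1 ≠ 0 := by positivity
    have hπ : (Real.pi : ℝ) ^ 2 ≠ 0 := by positivity
    field_simp
  refine ⟨rampForce 1, hsm, hdf, fun j => 1 / ((j : ℝ) + 1), fun j => rampState (((j : ℝ) + 1) / (4 * Real.pi ^ 2)) 1,
    fun _ => zeroPressure, fun j => by positivity, tendsto_one_div_add_atTop_nhds_zero_nat,
    fun j => isClassicalNSSolutionOn_ramp (ha j) 1, ⟨0, fun j => (meanEnergy_rampState _ one_ne_zero).le⟩,
    1 / (8 * Real.pi ^ 2), by positivity, fun j => ?_⟩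
  rw [meanDissipation_rampState]
  have hj : (0 : ℝ) < (j : ℝ) + 1 := by positivity
  have heq : 1 / ((j : ℝ) + 1) * (2 * Real.pi ^ 2 * (((j : ℝ) + 1) / (4 * Real.pi ^ 2)) ^ 2) =
      ((j : ℝ) + 1) / (8 * Real.pi ^ 2) := by
    have hj' : (j : ℝ) + 1 ≠ 0 := by positivity
    have hπ : (Real.pi : ℝ) ^ 2 ≠ 0 := by positivity
    field_simp
    ring
  rw [heq]
  exact div_le_div_of_nonneg_right (by linarith) (by positivity)

/-! ## §4 Honesty of the energy ceiling -/

/-- **THE ENERGY CEILING IS HONEST on the crux's class.**  For a complete classical trajectory with `ν > 0` under a steady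
smooth MEAN-ZERO force, the Cesàro means of the energy are bounded for `T ≥ 1`
(`T⁻¹∫₀ᵀ‖u‖² ≤ ½‖u(0)‖²/(2π²ν) + 2‖∫u(1)‖² + ‖f‖₂²/(16π⁴ν²)`: momentum conservation, Poincaré on the fluctuation, energy
inequality — `Torus.IsGlobalLerayHopf.timeMean_norm_sq_le`, in tree), so `meanEnergy u` is a genuine `limsup` and the
junk route of §3 (`meanEnergy = 0` by unboundedness) is closed exactly by `HasZeroMean f`. [cite: DoeringFoias2002, §2] -/
theorem timeMean_energy_le {ν : ℝ} (hν : 0 < ν) {f : 𝕋³ → E³} (hf : IsSmooth f) (hf0 : HasZeroMean f)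
    {u : ℝ → 𝕋³ → E³} {p : ℝ → 𝕋³ → ℝ} (h : IsClassicalNSSolutionOn univ ν (fun _ => f) u p) {T : ℝ}
    (hT : 1 ≤ T) :
    timeMean (fun t => ∫ x, ‖u t x‖ ^ 2) T ≤
      kineticEnergy (u 0) / (2 * Real.pi ^ 2 * ν) +
        (2 * ‖∫ x, u 1 x‖ ^ 2 + (∫ x, ‖f x‖ ^ 2) / (16 * Real.pi ^ 4 * ν ^ 2)) :=
  h.isGlobalLerayHopf.timeMean_norm_sq_le hν hf hf0 hT

/-- Hence the Cesàro energies of such a trajectory are eventually bounded above (the `limsup` in `meanEnergy` is not the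
junk `sInf ∅`). [folklore] -/
theorem isBoundedUnder_timeMean_energy {ν : ℝ} (hν : 0 < ν) {f : 𝕋³ → E³} (hf : IsSmooth f) (hf0 : HasZeroMean f)
    {u : ℝ → 𝕋³ → E³} {p : ℝ → 𝕋³ → ℝ} (h : IsClassicalNSSolutionOn univ ν (fun _ => f) u p) :
    IsBoundedUnder (· ≤ ·) atTop (timeMean fun t => ∫ x, ‖u t x‖ ^ 2) :=
  ⟨_, eventually_map.2 (eventually_atTop.2 ⟨1, fun _ hT => timeMean_energy_le hν hf hf0 h hT⟩)⟩

/-! ## §5 Kill shape and hierarchy -/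

/-- THE EXACT NEGATION (negative zeroth law in the complete classical class): for every steady smooth solenoidal
mean-zero force, every `ν_j → 0⁺` and every family of complete classical trajectories with bounded mean energy, the
mean dissipation tends to `0`. -/
def ChainNeg : Prop :=
  ∀ f : 𝕋³ → E³, IsSmooth f → IsDivFree f → HasZeroMean f →
    ∀ (ν : ℕ → ℝ) (u : ℕ → ℝ → 𝕋³ → E³) (p : ℕ → ℝ → 𝕋³ → ℝ),
      (∀ j, 0 < ν j) → Tendsto ν atTop (𝓝 0) →
      (∀ j, IsClassicalNSSolutionOn univ (ν j) (fun _ => f) (u j) (p j)) →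
      (∃ E : ℝ, ∀ j, meanEnergy (u j) ≤ E) →
      Tendsto (fun j => meanDissipation (ν j) (u j)) atTop (𝓝 0)

/-- **KILL SHAPE.** `¬ ChainThesis ↔ ChainNeg`: no gap is left by the `limsup`/`toReal` conventions or by the
"`∃ ε ∀ j`" versus "`¬ Tendsto … 0`" phrasing (`←`: evaluate on a witness; `→`: if some admissible family has
`meanDissipation ↛ 0`, then as `meanDissipation ≥ 0` some `ε > 0` is reached frequently; extract a subsequence —
all hypotheses pass to subsequences).  A kill of the crux is exactly a proof of the negative zeroth law for complete
classical trajectories under one steady force. [folklore] -/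
theorem not_chainThesis_iff_chainNeg : ¬ ChainThesis ↔ ChainNeg := by
  constructor
  · intro hX f hs hd hz ν u p hν hν0 hsol hE
    by_contra hnt
    have hfreq : ∃ ε : ℝ, 0 < ε ∧ ∃ᶠ j in atTop, ε ≤ meanDissipation (ν j) (u j) := by
      by_contra hall
      push Not at hall
      apply hnt
      rw [tendsto_order]
      exact ⟨fun b hb => Eventually.of_forall fun j => hb.trans_le (meanDissipation_nonneg (hν j).le _),
        fun b hb => hall b hb⟩
    obtain ⟨ε, hε, hfr⟩ := hfreq
    obtain ⟨φ, hφ, hφε⟩ := extraction_of_frequently_atTop hfr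
    exact hX ⟨f, hs, hd, hz, ν ∘ φ, u ∘ φ, p ∘ φ, fun j => hν (φ j), hν0.comp hφ.tendsto_atTop,
      fun j => hsol (φ j), ⟨hE.choose, fun j => hE.choose_spec (φ j)⟩, ε, hε, hφε⟩
  · rintro hneg ⟨f, hs, hd, hz, ν, u, p, hν, hν0, hsol, hE, ε, hε, hεj⟩
    have ht := hneg f hs hd hz ν u p hν hν0 hsol hE
    obtain ⟨j, hj⟩ := (ht.eventually (gt_mem_nhds hε)).exists
    exact (not_lt.2 (hεj j)) hj

/-- **HIERARCHY, down**: the summit's negative thesis (route `Neg` target `NegThesis`, Leray–Hopf class) implies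
`ChainNeg`, i.e. kills the crux (by `not_chainThesis_iff_chainNeg`) — complete classical trajectories are global
Leray–Hopf from `u 0` (`Torus.IsClassicalNSSolutionOn.isGlobalLerayHopf`).  Stated with conclusion `ChainNeg` (not
`¬ ChainThesis`) so that no audit reads a conditional refutation into it: `NegThesis` is itself open. [folklore] -/
theorem chainNeg_of_negThesis (hN : Neg.NegThesis) : ChainNeg := by
  intro f hs hd hz ν u p hν hν0 hsol hE
  exact hN f hs hd hz ν (fun j => u j 0) u hν hν0 (fun j => (hsol j).isGlobalLerayHopf) hE

/-- **HIERARCHY, up**: a kill of the crux kills the target of route `CoherentStates` (`CoherentThesis`: the same with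
time-PERIODIC complete classical trajectories) — periodic witnesses are witnesses. [folklore] -/
theorem not_coherentThesis_of_not_chainThesis (h : ¬ ChainThesis) : ¬ CoherentStates.CoherentThesis := by
  rintro ⟨f, hs, hd, hz, ν, τ, u, p, hν, hν0, hsol, hE, hε⟩
  exact h ⟨f, hs, hd, hz, ν, u, p, hν, hν0, fun j => (hsol j).1, hE, hε⟩

/-- **HIERARCHY, summit**: the crux implies the summit (the route's deciding theorem `closes`), so `¬ AnomalousDissipation`
kills it; conversely NOTHING weaker than a negative zeroth law in the classical class does. [folklore] -/
theorem not_chainThesis_of_not_anomalousDissipation (h : ¬ _root_.AnomalousDissipation) : ¬ ChainThesis := by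
  -- buildfix 2026-08-19: the route's deciding theorem `MarginalStabilityChain.closes` no longer takes
  -- `ChainThesis` directly (rev ≥ 2: `closes h2 h3 h4 hR`); the one-line implication
  -- `ChainThesis → AnomalousDissipation` (its former body) is inlined here, statement unchanged.
  rintro ⟨f, hf, hdiv, hmean, ν, u, p, hν, hν0, hsol, hE, hε⟩
  exact h ⟨f, hf, hdiv, hmean, ν, fun j => u j 0, u, hν, hν0,
    fun j => (hsol j).isGlobalLerayHopf, hE, hε⟩

/-! ## §6 Refuted strengthenings of the witness class -/

/-- `meanDissipation ν u = ν · ⟨‖∇u‖²⟩` for `ν ≥ 0` (nonnegative constants leave the `limsup`, junk included). [folklore] -/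
theorem meanDissipation_eq_mul {ν : ℝ} (hν : 0 ≤ ν) (u : ℝ → 𝕋³ → E³) :
    meanDissipation ν u = ν * longTimeAvgSup (fun t => (eGradNormSq (u t)).toReal) := by
  unfold meanDissipation
  exact longTimeAvgSup_const_mul hν _

/-- `ChainThesis` STRENGTHENED by a `ν`-uniform bound on the mean enstrophy `⟨‖∇u_j‖²⟩ ≤ G`. -/
def ChainThesisBoundedEnstrophy : Prop :=
  ∃ f : 𝕋³ → E³, IsSmooth f ∧ IsDivFree f ∧ HasZeroMean f ∧
    ∃ (ν : ℕ → ℝ) (u : ℕ → ℝ → 𝕋³ → E³) (p : ℕ → ℝ → 𝕋³ → ℝ),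
      (∀ j, 0 < ν j) ∧ Tendsto ν atTop (𝓝 0) ∧
      (∀ j, IsClassicalNSSolutionOn univ (ν j) (fun _ => f) (u j) (p j)) ∧
      (∃ E : ℝ, ∀ j, meanEnergy (u j) ≤ E) ∧
      (∃ G : ℝ, ∀ j, longTimeAvgSup (fun t => (eGradNormSq (u j t)).toReal) ≤ G) ∧
      ∃ ε : ℝ, 0 < ε ∧ ∀ j, ε ≤ meanDissipation (ν j) (u j)

/-- **NO WITNESS WITH BOUNDED MEAN ENSTROPHY** (trivial but structural): `meanDissipation = ν_j⟨‖∇u_j‖²⟩ ≤ ν_j G → 0`.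
The mean enstrophy of a witness is `≥ ε/ν_j → ∞` at bounded energy: its Taylor microscale `λ_j² = Eν_j/ε → 0`, i.e.
gradients must concentrate at ever finer scales while `f` injects at scale one — a genuine cascade. [folklore] -/
theorem not_chainThesisBoundedEnstrophy : ¬ ChainThesisBoundedEnstrophy := by
  rintro ⟨f, -, -, -, ν, u, p, hν, hν0, -, -, ⟨G, hG⟩, ε, hε, hεj⟩
  have hle : ∀ j, ε ≤ ν j * G := fun j => by
    have h1 := hεj j
    rw [meanDissipation_eq_mul (hν j).le] at h1
    exact h1.trans (mul_le_mul_of_nonneg_left (hG j) (hν j).le)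
  have ht : Tendsto (fun j => ν j * G) atTop (𝓝 0) := by simpa using hν0.mul_const G
  obtain ⟨j, hj⟩ := (ht.eventually (gt_mem_nhds hε)).exists
  exact (not_lt.2 (hle j)) hj

end Summit.AnomalousDissipation.AnomalousDissipation.Cruxes.ChainThesis.Disproof

end
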